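import Mathlib

/-!
# Reflection supply by pigeonhole on involution words (crux `HyperoctahedralThreshold`, refutation line,
# siege on `stub_poorRigidCore`, variation "direct pigeonhole on involution words")

Three involutions `μ c` of `Fin n` without fixed points; colour words `List (Fin 3)` act on the right,
`x · z := z.foldl (fun v c => μ c v) x` (the convention of the line's stubs).  An INVOLUTION WORD is
`w ++ c :: w.reverse` with `w ++ [c]` reduced (`List.IsChain (· ≠ ·)`); it acts as a conjugate of `μ c`, hence
moves every point (`foldl_invWord_ne_self`).  There are at least `2 ^ L` of them with `w.length = L`
(an explicit reduced family `scanl`-generated from bit strings), so as soon as `n ≤ 2 ^ L` two DISTINCT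
involution words collide at any given vertex `v` (`exists_reflection_collision`) — the based "reflection
incidence" of crux NOTES §2 (S-refl) / §9 (S1): `v` is a fixed point of the product, a closed colour-walk of
length `≤ 4L + 2` through `v` that is the product of two involutions of `Z/2 ∗ Z/2 ∗ Z/2`.
`exists_reflection_collision_avoiding` adds a forbidden set `R`: by the bijection trick (for a fixed word and a
fixed time the trajectory point is an injective function of the start) at most `2^L · (2L+2) · |R|` based words
meet `R`, so under `n(n-1) + 2^L(2L+2)|R| < 2^L·n` some vertex carries `≥ n` involution words whose whole
trajectories avoid `R`, and two of those collide.  (With `2n ≤ 2^L ≤ 4n` and `|R| ≤ n^{3/4}` the hypothesis holds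
for all large `n`.)  Pure finite combinatorics; no definitions are introduced.
-/

set_option linter.dupNamespace false

namespace Summit.MatrixMultiplication.MatrixMultiplication.Theorems.HyperoctahedralThreshold.ReflectionSupply

open Finset

variable {n : ℕ}

/-! ## Two facts about the right action of words -/

/-- The action of a fixed word is injective (each letter acts by a permutation). -/
theorem foldl_perm_injective (μ : Fin 3 → Equiv.Perm (Fin n)) :
    ∀ w : List (Fin 3), Function.Injective (fun x => w.foldl (fun v c => μ c v) x) := by
  intro w
  induction w with
  | nil => exact fun x y h => h
  | cons c w ih =>
    intro x y h
    exact (μ c).injective (ih h)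

/-- An involution word `w ++ c :: w.reverse` moves every point (it acts as a conjugate of `μ c`). -/
theorem foldl_invWord_ne_self (μ : Fin 3 → Equiv.Perm (Fin n)) (hμ : ∀ c, μ c * μ c = 1)
    (hfpf : ∀ c v, μ c v ≠ v) : ∀ (w : List (Fin 3)) (c : Fin 3) (v : Fin n),
    (w ++ c :: w.reverse).foldl (fun v c => μ c v) v ≠ v := by
  intro w
  induction w with
  | nil => intro c v; simpa using hfpf c v
  | cons a w ih =>
    intro c v h
    have hlist : (a :: w) ++ c :: (a :: w).reverse = a :: ((w ++ c :: w.reverse) ++ [a]) := by simp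
    rw [hlist, List.foldl_cons, List.foldl_append] at h
    simp only [List.foldl_cons, List.foldl_nil] at h
    have hinv : ∀ x, μ a (μ a x) = x := fun x => by
      have : (μ a * μ a) x = x := by rw [hμ a]; rfl
      simpa using this
    have h' : (w ++ c :: w.reverse).foldl (fun v c => μ c v) (μ a v) = μ a v := by
      have := congrArg (μ a) h
      rwa [hinv] at this
    exact ih c (μ a v) h'

/-! ## An explicit family of `2 ^ L` reduced words: `scanl` of a bit string -/

/-- The successor-letter map never repeats the current letter. -/
theorem step_ne (x : Fin 3) (b : Bool) : (if b then x + 1 else x + 2) ≠ x := by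
  revert x b; decide

/-- The successor-letter map is injective in the bit. -/
theorem step_injective (x : Fin 3) (b b' : Bool)
    (h : (if b then x + 1 else x + 2) = (if b' then x + 1 else x + 2)) : b = b' := by
  revert x b b'; decide

/-- `scanl` starts with its seed. -/
theorem scanl_eq_cons (a : Fin 3) (bs : List Bool) :
    ∃ l, List.scanl (fun x b => if b then x + 1 else x + 2) a bs = a :: l := by
  cases bs with
  | nil => exact ⟨[], by simp⟩
  | cons b bs => exact ⟨_, List.scanl_cons⟩

/-- The `scanl`-generated word is reduced (consecutive letters differ). -/
theorem isChain_scanl : ∀ (bs : List Bool) (a : Fin 3),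
    List.IsChain (· ≠ ·) (List.scanl (fun x b => if b then x + 1 else x + 2) a bs) := by
  intro bs
  induction bs with
  | nil => intro a; simp
  | cons b bs ih =>
    intro a
    rw [List.scanl_cons]
    refine List.IsChain.cons (ih _) ?_
    intro y hy
    obtain ⟨l, hl⟩ := scanl_eq_cons (if b then a + 1 else a + 2) bs
    rw [hl] at hy
    simp only [List.head?_cons, Option.mem_def, Option.some.injEq] at hy
    rw [← hy]
    exact (step_ne a b).symm

/-- The `scanl`-generated word determines the bit string. -/
theorem scanl_injective : ∀ (bs bs' : List Bool) (a : Fin 3),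
    List.scanl (fun x b => if b then x + 1 else x + 2) a bs =
      List.scanl (fun x b => if b then x + 1 else x + 2) a bs' → bs = bs' := by
  intro bs
  induction bs with
  | nil =>
    intro bs' a h
    cases bs' with
    | nil => rfl
    | cons b' bs' =>
      have := congrArg List.length h
      simp [List.length_scanl] at this
  | cons b bs ih =>
    intro bs' a h
    cases bs' with
    | nil =>
      have := congrArg List.length h
      simp [List.length_scanl] at this
    | cons b' bs' =>
      rw [List.scanl_cons, List.scanl_cons] at h
      have htl := List.tail_eq_of_cons_eq h
      obtain ⟨l, hl⟩ := scanl_eq_cons (if b then a + 1 else a + 2) bs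
      obtain ⟨l', hl'⟩ := scanl_eq_cons (if b' then a + 1 else a + 2) bs'
      have hhd : (if b then a + 1 else a + 2) = (if b' then a + 1 else a + 2) := by
        have := congrArg List.head? htl
        rw [hl, hl'] at this
        simpa using this
      have hb : b = b' := step_injective a b b' hhd
      subst hb
      rw [ih bs' _ htl]


/-- The words of the family have length `L`. -/
theorem length_family {L : ℕ} (bs : List.Vector Bool L) :
    ((List.scanl (fun x b => if b then x + 1 else x + 2) (0 : Fin 3) bs.toList).tail.reverse).length = L := by
  simp [List.length_scanl]

/-- The words `w` of the family satisfy: `w ++ [0]` is reduced. -/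
theorem isChain_family {L : ℕ} (bs : List.Vector Bool L) :
    List.IsChain (· ≠ ·)
      ((List.scanl (fun x b => if b then x + 1 else x + 2) (0 : Fin 3) bs.toList).tail.reverse ++ [0]) := by
  obtain ⟨l, hl⟩ := scanl_eq_cons 0 bs.toList
  have hc := isChain_scanl bs.toList 0
  rw [hl] at hc ⊢
  have : (0 :: l).tail.reverse ++ [(0 : Fin 3)] = (0 :: l).reverse := by simp
  rw [this, List.isChain_reverse]
  exact hc.imp (fun a b h => fun h' => h h'.symm)

/-- The family is injective. -/
theorem family_injective {L : ℕ} (bs bs' : List.Vector Bool L)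
    (h : (List.scanl (fun x b => if b then x + 1 else x + 2) (0 : Fin 3) bs.toList).tail.reverse =
      (List.scanl (fun x b => if b then x + 1 else x + 2) (0 : Fin 3) bs'.toList).tail.reverse) : bs = bs' := by
  obtain ⟨l, hl⟩ := scanl_eq_cons 0 bs.toList
  obtain ⟨l', hl'⟩ := scanl_eq_cons 0 bs'.toList
  have h1 := congrArg List.reverse h
  simp only [List.reverse_reverse] at h1
  rw [hl, hl'] at h1
  simp only [List.tail_cons] at h1
  subst h1
  exact List.Vector.toList_injective (scanl_injective _ _ _ (hl.trans hl'.symm))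

/-- **Reflection supply at a vertex (S1).**  If `n ≤ 2 ^ L`, then at every vertex `v` two distinct involution
words `w ++ c :: w.reverse`, `w' ++ c' :: w'.reverse` (`w ++ [c]`, `w' ++ [c']` reduced, `|w| = |w'| = L`) collide:
pigeonhole, since each of the `≥ 2^L` involution words moves `v` into the `n - 1` other points. -/
theorem exists_reflection_collision (μ : Fin 3 → Equiv.Perm (Fin n)) (hμ : ∀ c, μ c * μ c = 1)
    (hfpf : ∀ c v, μ c v ≠ v) {L : ℕ} (hL : n ≤ 2 ^ L) (v : Fin n) :
    ∃ (w w' : List (Fin 3)) (c c' : Fin 3), (w ≠ w' ∨ c ≠ c') ∧ w.length = L ∧ w'.length = L ∧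
      List.IsChain (· ≠ ·) (w ++ [c]) ∧ List.IsChain (· ≠ ·) (w' ++ [c']) ∧
      (w ++ c :: w.reverse).foldl (fun v c => μ c v) v =
        (w' ++ c' :: w'.reverse).foldl (fun v c => μ c v) v := by
  classical
  set F : List.Vector Bool L → List (Fin 3) := fun bs =>
    (List.scanl (fun x b => if b then x + 1 else x + 2) (0 : Fin 3) bs.toList).tail.reverse with hF
  have hmaps : Set.MapsTo (fun bs => (F bs ++ (0 : Fin 3) :: (F bs).reverse).foldl (fun v c => μ c v) v)
      ↑(Finset.univ : Finset (List.Vector Bool L)) ↑((Finset.univ : Finset (Fin n)).erase v) := by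
    intro bs _
    simp only [Finset.coe_erase, Finset.coe_univ, Set.mem_sdiff, Set.mem_univ, Set.mem_singleton_iff,
      true_and]
    exact foldl_invWord_ne_self μ hμ hfpf _ _ _
  have hcard : ((Finset.univ : Finset (Fin n)).erase v).card <
      (Finset.univ : Finset (List.Vector Bool L)).card := by
    rw [Finset.card_erase_of_mem (Finset.mem_univ v), Finset.card_univ, Finset.card_univ, card_vector,
      Fintype.card_bool, Fintype.card_fin]
    have := v.pos
    omega
  obtain ⟨bs, -, bs', -, hne, heq⟩ := Finset.exists_ne_map_eq_of_card_lt_of_maps_to hcard hmaps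
  refine ⟨F bs, F bs', 0, 0, Or.inl ?_, length_family bs, length_family bs', isChain_family bs,
    isChain_family bs', heq⟩
  intro hFF
  exact hne (family_injective bs bs' hFF)

/-- **Reflection supply avoiding a forbidden set (S1 + bijection trick).**  If
`n(n-1) + 2^L·(2L+2)·|R| < 2^L·n`, some vertex `v` carries two distinct colliding involution words (as in
`exists_reflection_collision`) whose trajectories from `v` — all points `v · (ι.take t)` — avoid `R`.  Proof: for a
fixed word and time the trajectory point is an injective function of `v`, so at most `2^L(2L+2)|R|` pairs
`(v, word)` meet `R`; hence some `v` has `≥ n` words avoiding `R`, and two of them collide by pigeonhole. -/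
theorem exists_reflection_collision_avoiding (μ : Fin 3 → Equiv.Perm (Fin n)) (hμ : ∀ c, μ c * μ c = 1)
    (hfpf : ∀ c v, μ c v ≠ v) {L : ℕ} (R : Finset (Fin n))
    (hL : n * (n - 1) + 2 ^ L * ((2 * L + 2) * R.card) < 2 ^ L * n) :
    ∃ (v : Fin n) (w w' : List (Fin 3)) (c c' : Fin 3), (w ≠ w' ∨ c ≠ c') ∧ w.length = L ∧ w'.length = L ∧
      List.IsChain (· ≠ ·) (w ++ [c]) ∧ List.IsChain (· ≠ ·) (w' ++ [c']) ∧
      (w ++ c :: w.reverse).foldl (fun v c => μ c v) v =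
        (w' ++ c' :: w'.reverse).foldl (fun v c => μ c v) v ∧
      (∀ t, ((w ++ c :: w.reverse).take t).foldl (fun v c => μ c v) v ∉ R) ∧
      (∀ t, ((w' ++ c' :: w'.reverse).take t).foldl (fun v c => μ c v) v ∉ R) := by
  classical
  set F : List.Vector Bool L → List (Fin 3) := fun bs =>
    (List.scanl (fun x b => if b then x + 1 else x + 2) (0 : Fin 3) bs.toList).tail.reverse with hF
  -- the involution word of `bs` and its trajectory points
  set ι : List.Vector Bool L → List (Fin 3) := fun bs => F bs ++ (0 : Fin 3) :: (F bs).reverse with hι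
  have hιlen : ∀ bs, (ι bs).length = 2 * L + 1 := by
    intro bs
    have h := length_family bs
    simp only [hι, hF, List.length_append, List.length_cons, List.length_reverse] at h ⊢
    omega
  -- good pairs: the first `2L+2` trajectory points avoid `R`
  set good : Fin n → List.Vector Bool L → Prop := fun v bs =>
    ∀ t, t < 2 * L + 2 → ((ι bs).take t).foldl (fun v c => μ c v) v ∉ R with hgood
  -- (1) for fixed `bs, t` at most `|R|` starting points have their `t`-th point in `R`
  have hfib : ∀ (bs : List.Vector Bool L) (t : ℕ),
      ((Finset.univ : Finset (Fin n)).filter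
        (fun v => ((ι bs).take t).foldl (fun v c => μ c v) v ∈ R)).card ≤ R.card := by
    intro bs t
    refine Finset.card_le_card_of_injOn (fun v => ((ι bs).take t).foldl (fun v c => μ c v) v) ?_ ?_
    · intro v hv
      simpa using hv
    · intro v _ v' _ hvv'
      exact foldl_perm_injective μ _ hvv'
  -- (2) the bad pairs at `v` are few in total
  have hbad : ∑ v : Fin n, ((Finset.univ : Finset (List.Vector Bool L)).filter (fun bs => ¬ good v bs)).card
      ≤ 2 ^ L * ((2 * L + 2) * R.card) := by
    calc ∑ v : Fin n, ((Finset.univ : Finset (List.Vector Bool L)).filter (fun bs => ¬ good v bs)).card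
        ≤ ∑ v : Fin n, ∑ bs : List.Vector Bool L, ∑ t ∈ Finset.range (2 * L + 2),
            (if ((ι bs).take t).foldl (fun v c => μ c v) v ∈ R then 1 else 0) := by
          refine Finset.sum_le_sum fun v _ => ?_
          rw [Finset.card_filter]
          refine Finset.sum_le_sum fun bs _ => ?_
          by_cases hb : ¬ good v bs
          · rw [if_pos hb]
            simp only [hgood, not_forall, not_not, exists_prop] at hb
            obtain ⟨t, ht, htR⟩ := hb
            have h1 := Finset.single_le_sum (f := fun t =>
              if ((ι bs).take t).foldl (fun v c => μ c v) v ∈ R then 1 else 0)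
              (fun _ _ => Nat.zero_le _) (Finset.mem_range.2 ht)
            rw [if_pos htR] at h1
            exact h1
          · rw [if_neg hb]
            exact Nat.zero_le _
      _ = ∑ bs : List.Vector Bool L, ∑ t ∈ Finset.range (2 * L + 2), ∑ v : Fin n,
            (if ((ι bs).take t).foldl (fun v c => μ c v) v ∈ R then 1 else 0) := by
          rw [Finset.sum_comm]
          refine Finset.sum_congr rfl fun bs _ => ?_
          rw [Finset.sum_comm]
      _ ≤ ∑ bs : List.Vector Bool L, ∑ t ∈ Finset.range (2 * L + 2), R.card := by
          refine Finset.sum_le_sum fun bs _ => Finset.sum_le_sum fun t _ => ?_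
          rw [← Finset.card_filter]
          exact hfib bs t
      _ = 2 ^ L * ((2 * L + 2) * R.card) := by
          simp [Finset.sum_const, Finset.card_univ, card_vector, Fintype.card_bool]
  -- (3) some vertex has at least `n` good words
  have hv : ∃ v : Fin n, n - 1 <
      ((Finset.univ : Finset (List.Vector Bool L)).filter (fun bs => good v bs)).card := by
    by_contra hcon
    push Not at hcon
    have hsplit : ∀ v : Fin n,
        ((Finset.univ : Finset (List.Vector Bool L)).filter (fun bs => good v bs)).card +
          ((Finset.univ : Finset (List.Vector Bool L)).filter (fun bs => ¬ good v bs)).card = 2 ^ L := by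
      intro v
      rw [Finset.card_filter_add_card_filter_not, Finset.card_univ, card_vector, Fintype.card_bool]
    have hsum : ∑ v : Fin n, (2 ^ L) ≤ n * (n - 1) + 2 ^ L * ((2 * L + 2) * R.card) := by
      calc ∑ v : Fin n, (2 ^ L)
          = ∑ v : Fin n, (((Finset.univ : Finset (List.Vector Bool L)).filter (fun bs => good v bs)).card +
              ((Finset.univ : Finset (List.Vector Bool L)).filter (fun bs => ¬ good v bs)).card) := by
            refine Finset.sum_congr rfl fun v _ => (hsplit v).symm
        _ = ∑ v : Fin n, ((Finset.univ : Finset (List.Vector Bool L)).filter (fun bs => good v bs)).card +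
              ∑ v : Fin n, ((Finset.univ : Finset (List.Vector Bool L)).filter (fun bs => ¬ good v bs)).card :=
            Finset.sum_add_distrib
        _ ≤ ∑ v : Fin n, (n - 1) + 2 ^ L * ((2 * L + 2) * R.card) :=
            Nat.add_le_add (Finset.sum_le_sum fun v _ => hcon v) hbad
        _ = n * (n - 1) + 2 ^ L * ((2 * L + 2) * R.card) := by
            simp [Finset.sum_const, Finset.card_univ, Fintype.card_fin]
    have : ∑ v : Fin n, (2 ^ L) = 2 ^ L * n := by
      simp [Finset.sum_const, Finset.card_univ, Fintype.card_fin, mul_comm]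
    omega
  obtain ⟨v, hv⟩ := hv
  -- (4) pigeonhole among the good words at `v`
  have hmaps : Set.MapsTo (fun bs => (ι bs).foldl (fun v c => μ c v) v)
      ↑((Finset.univ : Finset (List.Vector Bool L)).filter (fun bs => good v bs))
      ↑((Finset.univ : Finset (Fin n)).erase v) := by
    intro bs _
    simp only [Finset.coe_erase, Finset.coe_univ, Set.mem_sdiff, Set.mem_univ, Set.mem_singleton_iff,
      true_and]
    exact foldl_invWord_ne_self μ hμ hfpf _ _ _
  have hcard : ((Finset.univ : Finset (Fin n)).erase v).card <
      ((Finset.univ : Finset (List.Vector Bool L)).filter (fun bs => good v bs)).card := by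
    rw [Finset.card_erase_of_mem (Finset.mem_univ v), Finset.card_univ, Fintype.card_fin]
    exact hv
  obtain ⟨bs, hbs, bs', hbs', hne, heq⟩ := Finset.exists_ne_map_eq_of_card_lt_of_maps_to hcard hmaps
  rw [Finset.mem_filter] at hbs hbs'
  -- from the first `2L+2` points to all `t`
  have hall : ∀ bs, good v bs → ∀ t, ((ι bs).take t).foldl (fun v c => μ c v) v ∉ R := by
    intro bs hg t
    by_cases ht : t < 2 * L + 2
    · exact hg t ht
    · have h1 : (ι bs).take t = ι bs := List.take_of_length_le (by rw [hιlen]; omega)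
      have h2 : (ι bs).take (2 * L + 1) = ι bs := List.take_of_length_le (by rw [hιlen])
      rw [h1, ← h2]
      exact hg (2 * L + 1) (by omega)
  refine ⟨v, F bs, F bs', 0, 0, Or.inl ?_, length_family bs, length_family bs', isChain_family bs,
    isChain_family bs', heq, hall bs hbs.2, hall bs' hbs'.2⟩
  intro hFF
  exact hne (family_injective bs bs' hFF)

/-- **Registered helper stub `stub_reflectionSupply`** (crux stmt-MatrixMultiplication-10883, refutation line
`refutation_local_symmetry`, supply (S1) of crux NOTES §2/§9 with the forbidden set built in): for three fixed-point-free
involutions of `Fin n`, a forbidden set `R` and a radius `L` with `n(n-1) + 2^L(2L+2)|R| < 2^L·n`, some vertex carries two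
distinct colliding involution words of radius `L` whose trajectories avoid `R` — verbatim `exists_reflection_collision_avoiding`. -/
theorem stub_reflectionSupply : ∀ (n L : ℕ) (μ : Fin 3 → Equiv.Perm (Fin n)) (R : Finset (Fin n)), (∀ c, μ c * μ c = 1) → (∀ c v, μ c v ≠ v) → n * (n - 1) + 2 ^ L * ((2 * L + 2) * R.card) < 2 ^ L * n → ∃ (v : Fin n) (w w' : List (Fin 3)) (c c' : Fin 3), (w ≠ w' ∨ c ≠ c') ∧ w.length = L ∧ w'.length = L ∧ List.IsChain (· ≠ ·) (w ++ [c]) ∧ List.IsChain (· ≠ ·) (w' ++ [c']) ∧ (w ++ c :: w.reverse).foldl (fun v c => μ c v) v = (w' ++ c' :: w'.reverse).foldl (fun v c => μ c v) v ∧ (∀ t, ((w ++ c :: w.reverse).take t).foldl (fun v c => μ c v) v ∉ R) ∧ (∀ t, ((w' ++ c' :: w'.reverse).take t).foldl (fun v c => μ c v) v ∉ R) :=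
  fun _n _L μ R hμ hfpf hL => exists_reflection_collision_avoiding μ hμ hfpf R hL

end Summit.MatrixMultiplication.MatrixMultiplication.Theorems.HyperoctahedralThreshold.ReflectionSupply
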